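import Mathlib
import Summits.ValiantsHypothesis.ValiantsHypothesis.Theorems.NewtonUnitEquationsDissociatedUniformTotalsLaw
import Summits.ValiantsHypothesis.ValiantsHypothesis.Theorems.NewtonUnitEquationsDissociatedUniformTotalsLawThirdCurveRuns
import HarnessLib

/-!
# Crux `NewtonUnitEquations.DissociatedUniform` (stmt-ValiantsHypothesis-5905), `n = 3` totals law of model (Q**):
# the runs law for the runs of ANY of the three curves — `T(a,b,c) ≤ (2 + 24·min(R(a),R(b),R(c)))·q²`

`…TotalsLawThirdCurveRuns.totalVert_le_runs` bounds `T(a,b,c)` by `(2 + 24·R(c))·q²` with the runs of the THIRD curve; by the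
symmetries `totalVert_rotate` / `totalVert_swap` of `…TotalsLaw` the same holds with the runs of the first or the second curve, hence
with the minimum:
* `totalVert_le_runs_fst`, `totalVert_le_runs_snd` (runs of `a`, of `b`);
* `totalVert_le_runs_min : T(a,b,c) ≤ (2 + 24·min (min R(a) R(b)) R(c))·q²`.
Honest label: `TotalsLawThree C` (a constant independent of the runs) remains OPEN and is asserted nowhere; nothing here bears on
VP ≠ VNP. [folklore]
-/

set_option linter.dupNamespace false -- `ValiantsHypothesis.ValiantsHypothesis` (summit = problem) in every name

namespace Summit.ValiantsHypothesis.ValiantsHypothesis.Theorems.NewtonUnitEquationsDissociatedUniform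

namespace TotalsLaw

variable {q : ℕ} [NeZero q] [DecidableEq (Fin 2 → ℝ)]

/-- **Runs of the FIRST curve:** `T(a,b,c) ≤ (2 + 24·R(a))·q²`. -/
theorem totalVert_le_runs_fst (a b c : ZMod q → (Fin 2 → ℝ)) :
    totalVert a b c ≤ (2 + 24 * (runStarts a).card) * q ^ 2 := by
  rw [totalVert_rotate a b c]
  exact totalVert_le_runs b c a

/-- **Runs of the SECOND curve:** `T(a,b,c) ≤ (2 + 24·R(b))·q²`. -/
theorem totalVert_le_runs_snd (a b c : ZMod q → (Fin 2 → ℝ)) :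
    totalVert a b c ≤ (2 + 24 * (runStarts b).card) * q ^ 2 := by
  rw [totalVert_swap a b c]
  exact totalVert_le_runs_fst b a c

/-- **THE RUNS LAW, symmetric form:** `T(a,b,c) ≤ (2 + 24·min(R(a), R(b), R(c)))·q²` for ALL `a b c : ℤ/q → ℝ²`. -/
theorem totalVert_le_runs_min (a b c : ZMod q → (Fin 2 → ℝ)) :
    totalVert a b c ≤ (2 + 24 * min (min (runStarts a).card (runStarts b).card) (runStarts c).card) * q ^ 2 := by
  rcases le_total (min (runStarts a).card (runStarts b).card) (runStarts c).card with h | h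
  · rw [min_eq_left h]
    rcases le_total (runStarts a).card (runStarts b).card with h' | h'
    · rw [min_eq_left h']; exact totalVert_le_runs_fst a b c
    · rw [min_eq_right h']; exact totalVert_le_runs_snd a b c
  · rw [min_eq_right h]; exact totalVert_le_runs a b c

end TotalsLaw

end Summit.ValiantsHypothesis.ValiantsHypothesis.Theorems.NewtonUnitEquationsDissociatedUniform
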